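import Literature.Analysis.FluidPDE.LinearisedNSFourierDefs
import HarnessLib

/-!
# Fourier-side objects for the perturbed Navier–Stokes system on `T^d`: definitions

Analysis/FluidPDE definition file of the files `PerturbedNSFourier*` proving **short-time
existence of smooth solutions of the perturbed Navier–Stokes system** around a smooth
divergence-free background `u` (the Cheskidov–Luo perturbation / corrector system,
Cheskidov–Luo 2022, §3.1 (3.2), with a NONZERO datum, zero stress and a general viscosity
`ν > 0`),

  `∂ₜv + (v·∇)v + (u·∇)v + (v·∇)u + ∇q = νΔv`, `div v = 0`, `v(0) = v₀`, `∫ v(t) = 0`,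

on a short model interval `[0, θ]` (`0 < θ ≤ 1`), with a life span depending on the datum only
through a bound of its fourth Sobolev sums and on the background only through sup-in-time
decay constants of its Fourier coefficients (Majda–Bertozzi 2002, Thm. 3.4: the `H^m` local
theory, `m > d/2 + 1`; here `m = 4`, `d ≤ 3`). As for the zero-datum system
(`CorrectorFourier*`) and the linearised system (`LinearisedNSFourier*`), the solution is
constructed on the Fourier side: the unknown is the family of coefficient fields
`c l t k = 𝓕(vₗ(t))(k)`; with the drift coefficients `Uⱼ = ûⱼ` the convective terms have
coefficients `CorrectorFourier.convSym U 0 c` (zero stress), the Leray projector is the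
lattice symbol `CorrectorFourier.leraySym`, and the mild (Duhamel) form of the projected
equation,

  `c(l,t,k) = e^{-νₖτ} a(l,k) - ∫₀^τ e^{-νₖ(τ-s)} (P convSym)(U(s), 0, c(s))(l,k) ds`,
  `τ = clamp θ t`, `νₖ = 4π²ν|k|²` (`ScalarFourier.heatRate ν`),

is solved by Picard iteration (`picardMap`, `picardIter`, `picardLim`) in the ball of the
order-FOUR weighted sup-norm on the frequency lattice (`PerturbedNSFourierLattice`,
`PerturbedNSFourierEstimates`): the symbol loses one derivative and the heat factor regains it
at the price `gainConst ν · √θ`, so the map contracts once `√θ` is small against the ball and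
Lipschitz constants `ballConst`, `lipConst` of the order-four symbol estimates — the content of
the hypotheses `BallHyp`. This file only names the objects:

* `gainConst ν`, `ballConst d Z ρ A`, `lipConst d Z ρ A` — the constants of the threshold;
* `picardMap ν θ U a`, `picardIter`, `picardLim` — the clamped Duhamel map with datum `a`,
  its iterates from `0`, their pointwise limit; `PicardHyp ν θ U a` (qualitative hypotheses on
  the data), `BallHyp ν θ U a Z ρ A` (the quantitative threshold hypotheses);
* `bootRHS ν` — the candidate family of time derivatives (with `CorrectorFourier.projFamily` at
  zero stress), for the bootstrap of time regularity;
* `solCoeff ν θ u v₀`, `presCoeffField`, `velC`, `presC`, `vel`, `pres` — the solution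
  coefficients for a real background `u` (drift data `CorrectorFourier.driftCoeff θ u`) and
  datum `v₀` (datum data `LinearisedNSFourier.datumCoeff v₀`), the synthesized complex fields
  and their real parts.

All estimates and properties are in the sequel files (`PerturbedNSFourierPicard`,
`…Iteration`, `…Regularity`, `…Symmetry`, `…TimeRegularity`, `…Data`, `…Synthesis`,
`…Solution`).

## References

* A. J. Majda, A. L. Bertozzi, *Vorticity and Incompressible Flow*, CUP 2002, Thm. 3.4. [`MajdaBertozziCUP2002`]
* A. Cheskidov, X. Luo, *Sharp nonuniqueness for the Navier–Stokes equations*, Invent. Math. 229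
  (2022) = arXiv:2009.06596, §3.1 (3.2), Prop. 3.2. [`CheskidovLuo2022`]
* P. G. Lemarié-Rieusset, *The Navier–Stokes problem in the 21st century*, CRC 2016, §6.1
  (Leray projector as a Fourier multiplier), §8.5 (mild formulation in weighted sup-norms).
* L. Grafakos, *Classical Fourier Analysis*, 3rd ed. (2014), Prop. 3.2.6 (8), §3.3.1. [`Grafakos2014`]
-/

noncomputable section

open MeasureTheory Real Set Filter Topology UnitAddTorus

namespace Literature.Analysis.FluidPDE

namespace PerturbedNSFourier

open ScalarFourier
open CorrectorFourier (leraySym projSym presCoef projFamily driftCoeff)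
open LinearisedNSFourier (datumCoeff)
open FourierNS (HasDecay clamp)
open Literature.Analysis.FunctionSpaces.Torus (freqNormSq)

variable {d : Type*} [Fintype d]

/-! ### The constants of the threshold -/

section Constants

/-- The **heat-gain constant** at viscosity `ν` on intervals of length at most one:
`e · (1 + 1/(2√(4π²ν)))` — on `[0, θ]`, `θ ≤ 1`, the Duhamel integral against the heat factor
regains one derivative at the price `gainConst ν · √θ` (`ScalarFourier.heat_weight_gain` with
the time weight `λ = 1/θ`). [folklore] -/
def gainConst (ν : ℝ) : ℝ := Real.exp 1 * (1 + 1 / (2 * Real.sqrt (4 * π ^ 2 * ν)))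

/-- Unfolding `gainConst`. [folklore] -/
theorem gainConst_def (ν : ℝ) : gainConst ν = Real.exp 1 * (1 + 1 / (2 * Real.sqrt (4 * π ^ 2 * ν))) := rfl

/-- The **ball constant** `64π #d² Z ρ(ρ + 2A)`: the order-three constant of the projected
convective symbol `P convSym(U, 0, c)` for velocity coefficients in the order-four ball of
radius `ρ` and drift coefficients of order-four constant `A`, on a lattice of order-four mass
`Z` (`hasDecay_convSym_four` and the projector factor `2#d`). [folklore] -/
def ballConst (d : Type*) [Fintype d] (Z ρ A : ℝ) : ℝ :=
  64 * π * (Fintype.card d : ℝ) ^ 2 * Z * (ρ * (ρ + 2 * A))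

/-- Unfolding `ballConst`. [folklore] -/
theorem ballConst_def (Z ρ A : ℝ) :
    ballConst d Z ρ A = 64 * π * (Fintype.card d : ℝ) ^ 2 * Z * (ρ * (ρ + 2 * A)) := rfl

/-- The **Lipschitz constant** `128π #d² Z (ρ + A)`: the order-three constant, per unit of the
order-four constant of `c - c'`, of `P convSym(U, 0, c) - P convSym(U, 0, c')` for `c`, `c'` in
the order-four ball of radius `ρ` (`hasDecay_convSym_sub_four` and the projector factor
`2#d`). [folklore] -/
def lipConst (d : Type*) [Fintype d] (Z ρ A : ℝ) : ℝ :=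
  128 * π * (Fintype.card d : ℝ) ^ 2 * Z * (ρ + A)

/-- Unfolding `lipConst`. [folklore] -/
theorem lipConst_def (Z ρ A : ℝ) :
    lipConst d Z ρ A = 128 * π * (Fintype.card d : ℝ) ^ 2 * Z * (ρ + A) := rfl

end Constants

/-! ### The Picard iteration on `[0, θ]` -/

section Picard

variable [DecidableEq d]

/-- The **clamped Duhamel (Picard) map** of the mild formulation of the projected perturbed
system with datum `a`, viscosity `ν` and zero stress on `[0, θ]`: with `τ = clamp θ t`,
`Φ(c)(l, t, k) = e^{-νₖτ} a(l,k) - ∫₀^τ e^{-νₖ(τ-s)} (P convSym)(U(s), 0, c(s))(l, k) ds`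
(on `[0, θ]` the genuine Duhamel formula for `∂ₜcₗ = -νₖ cₗ - (P G)ₗ`). [folklore] -/
def picardMap (ν θ : ℝ) (U : d → ℝ → (d → ℤ) → ℂ) (a : d → (d → ℤ) → ℂ)
    (c : d → ℝ → (d → ℤ) → ℂ) (l : d) (t : ℝ) (k : d → ℤ) : ℂ :=
  (heatFactor ν k (clamp θ t) : ℂ) * a l k -
    ∫ s in (0 : ℝ)..clamp θ t, (heatFactor ν k (clamp θ t - s) : ℂ) *
      projSym (fun j => U j s) 0 (fun j => c j s) l k

/-- The **Picard iterates** `c₀ = 0`, `cₙ₊₁ = Φ(cₙ)`. [folklore] -/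
def picardIter (ν θ : ℝ) (U : d → ℝ → (d → ℤ) → ℂ) (a : d → (d → ℤ) → ℂ) :
    ℕ → d → ℝ → (d → ℤ) → ℂ
  | 0 => fun _ _ _ => 0
  | n + 1 => picardMap ν θ U a (picardIter ν θ U a n)

/-- `c₀ = 0`. [folklore] -/
@[simp]
theorem picardIter_zero (ν θ : ℝ) (U : d → ℝ → (d → ℤ) → ℂ) (a : d → (d → ℤ) → ℂ) :
    picardIter ν θ U a 0 = fun _ _ _ => 0 := rfl

/-- `cₙ₊₁ = Φ(cₙ)`. [folklore] -/
theorem picardIter_succ (ν θ : ℝ) (U : d → ℝ → (d → ℤ) → ℂ) (a : d → (d → ℤ) → ℂ) (n : ℕ) :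
    picardIter ν θ U a (n + 1) = picardMap ν θ U a (picardIter ν θ U a n) := rfl

/-- The **Picard limit** `c(l, t, k) = limₙ cₙ(l, t, k)` (pointwise `limUnder`; the genuine
limit under `BallHyp`, file `PerturbedNSFourierIteration`). [folklore] -/
def picardLim (ν θ : ℝ) (U : d → ℝ → (d → ℤ) → ℂ) (a : d → (d → ℤ) → ℂ) (l : d) (t : ℝ)
    (k : d → ℤ) : ℂ :=
  limUnder atTop fun n => picardIter ν θ U a n l t k

/-- **Qualitative hypotheses on the Fourier-side data**: `ν > 0`, `0 < θ ≤ 1`; the drift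
coefficients `Uⱼ(t)` are continuous in `t ∈ ℝ` at every frequency and have every polynomial
decay uniformly in `t ∈ ℝ` and `j` (in the application: the coefficients of the smooth
background at clamped time); the datum `a l` has every polynomial decay. [folklore] -/
structure PicardHyp (ν θ : ℝ) (U : d → ℝ → (d → ℤ) → ℂ) (a : d → (d → ℤ) → ℂ) : Prop where
  /-- positive viscosity -/
  hν : 0 < ν
  /-- positive interval length -/
  hθ : 0 < θ
  /-- interval length at most one -/
  hθ1 : θ ≤ 1
  /-- the drift coefficients are continuous in time at each frequency -/
  contU : ∀ j m, Continuous fun t => U j t m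
  /-- every polynomial decay of the drift coefficients, uniformly in time and component -/
  decayU : ∀ K : ℕ, ∃ A : ℝ, ∀ j t, HasDecay K A (U j t)
  /-- every polynomial decay of the datum, uniformly in the component -/
  decayA : ∀ K : ℕ, ∃ A₀ : ℝ, ∀ l, HasDecay K A₀ (a l)

/-- **Quantitative (threshold) hypotheses of the short-time contraction**: on a lattice of
order-four mass `Z` (`∑ₘ (1+‖m‖)^{-4} = Z`), the drift coefficients have order-four constant
`A` at all times, the datum lies in the order-four ball of radius `ρ/2`, and `√θ` is small
against the ball and Lipschitz constants: `gainConst ν √θ · ballConst ≤ ρ/2`,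
`gainConst ν √θ · lipConst ≤ 1/2` — so that the Duhamel map sends the order-four ball of radius
`ρ` to itself and contracts by `1/2` (the "sufficiently small `τ`" of Cheskidov–Luo 2022,
§3.1, quantified through the datum size and the background). [folklore] -/
structure BallHyp (ν θ : ℝ) (U : d → ℝ → (d → ℤ) → ℂ) (a : d → (d → ℤ) → ℂ) (Z ρ A : ℝ) : Prop
    extends PicardHyp ν θ U a where
  /-- the order-four mass of the lattice -/
  hZ : HasSum (fun m : d → ℤ => ((1 + ‖m‖) ^ 4)⁻¹) Z
  /-- nonnegative radius -/
  hρ : 0 ≤ ρ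
  /-- nonnegative drift constant -/
  hA : 0 ≤ A
  /-- order-four decay of the drift coefficients, uniformly in time and component -/
  hU4 : ∀ j t, HasDecay 4 A (U j t)
  /-- the datum lies in the order-four ball of radius `ρ/2` -/
  ha4 : ∀ l, HasDecay 4 (ρ / 2) (a l)
  /-- the ball inequality of the threshold -/
  hS1 : gainConst ν * Real.sqrt θ * ballConst d Z ρ A ≤ ρ / 2
  /-- the contraction inequality of the threshold -/
  hS2 : gainConst ν * Real.sqrt θ * lipConst d Z ρ A ≤ 1 / 2

end Picard

/-! ### Families of time derivatives -/

section Family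

variable [DecidableEq d]

/-- The **right-hand side of the differentiated mild system** along a velocity family `CF`:
`(bootRHS ν UF CF) l i = -νₖ CF l i - projFamily UF 0 CF l i` (`CorrectorFourier.projFamily`
at zero stress family), the candidate for `∂ₜ (CF l i)` when `CF l 0 = cₗ` solves
`∂ₜcₗ = -νₖ cₗ - (P G)ₗ`. [folklore] -/
def bootRHS (ν : ℝ) (UF : d → ℕ → ℝ → (d → ℤ) → ℂ) (CF : d → ℕ → ℝ → (d → ℤ) → ℂ) (l : d) :
    ℕ → ℝ → (d → ℤ) → ℂ :=
  fun i t k => -(heatRate ν k : ℂ) * CF l i t k - projFamily UF 0 CF l i t k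

/-- Unfolding `bootRHS`. [folklore] -/
theorem bootRHS_apply (ν : ℝ) (UF : d → ℕ → ℝ → (d → ℤ) → ℂ) (CF : d → ℕ → ℝ → (d → ℤ) → ℂ)
    (l : d) (i : ℕ) (t : ℝ) (k : d → ℤ) :
    bootRHS ν UF CF l i t k = -(heatRate ν k : ℂ) * CF l i t k - projFamily UF 0 CF l i t k := rfl

end Family

/-! ### The data of a real background and datum; the synthesized solution -/

section Data

variable [DecidableEq d]

/-- The **coefficient field of the short-time solution** of the perturbed system on `[0, θ]`
with background `u` and datum `v₀`: the Picard limit for the drift data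
`CorrectorFourier.driftCoeff θ u` (coefficients of the complexified components at clamped
time) and the datum data `LinearisedNSFourier.datumCoeff v₀` (`c(l, t, k) = 𝓕(vₗ(t))(k)` once
synthesized). [folklore] -/
def solCoeff (ν θ : ℝ) (u : ℝ → UnitAddTorus d → EuclideanSpace ℝ d)
    (v₀ : UnitAddTorus d → EuclideanSpace ℝ d) : d → ℝ → (d → ℤ) → ℂ :=
  picardLim ν θ (driftCoeff θ u) (datumCoeff v₀)

/-- The **pressure coefficient field** `q̂(t, k) = presCoef(U(t), 0, c(t))(k)`. [folklore] -/
def presCoeffField (ν θ : ℝ) (u : ℝ → UnitAddTorus d → EuclideanSpace ℝ d)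
    (v₀ : UnitAddTorus d → EuclideanSpace ℝ d) : ℝ → (d → ℤ) → ℂ :=
  fun t k => presCoef (fun j => driftCoeff θ u j t) 0 (fun j => solCoeff ν θ u v₀ j t) k

/-- Unfolding `presCoeffField`. [folklore] -/
theorem presCoeffField_apply (ν θ : ℝ) (u : ℝ → UnitAddTorus d → EuclideanSpace ℝ d)
    (v₀ : UnitAddTorus d → EuclideanSpace ℝ d) (t : ℝ) (k : d → ℤ) :
    presCoeffField ν θ u v₀ t k =
      presCoef (fun j => driftCoeff θ u j t) 0 (fun j => solCoeff ν θ u v₀ j t) k := rfl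

/-- The **synthesized complex velocity components** `Vₗ(t, x) = ∑ₖ c(l, t, k) e_k(x)`
(`ScalarFourier.torusSynth`; Grafakos 2014, §3.3.1). [folklore] -/
def velC (ν θ : ℝ) (u : ℝ → UnitAddTorus d → EuclideanSpace ℝ d)
    (v₀ : UnitAddTorus d → EuclideanSpace ℝ d) (l : d) : ℝ → UnitAddTorus d → ℂ :=
  torusSynth (solCoeff ν θ u v₀ l)

/-- The **synthesized complex pressure** `Q(t, x) = ∑ₖ q̂(t, k) e_k(x)`. [folklore] -/
def presC (ν θ : ℝ) (u : ℝ → UnitAddTorus d → EuclideanSpace ℝ d)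
    (v₀ : UnitAddTorus d → EuclideanSpace ℝ d) : ℝ → UnitAddTorus d → ℂ :=
  torusSynth (presCoeffField ν θ u v₀)

/-- The **velocity of the solution**: the real vector field with components `Re Vₗ` (the `Vₗ`
are real, `PerturbedNSFourierSymmetry`). [folklore] -/
def vel (ν θ : ℝ) (u : ℝ → UnitAddTorus d → EuclideanSpace ℝ d)
    (v₀ : UnitAddTorus d → EuclideanSpace ℝ d) : ℝ → UnitAddTorus d → EuclideanSpace ℝ d :=
  fun t x => WithLp.toLp 2 fun l => (velC ν θ u v₀ l t x).re

/-- The components of `vel`. [folklore] -/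
@[simp]
theorem vel_apply (ν θ : ℝ) (u : ℝ → UnitAddTorus d → EuclideanSpace ℝ d)
    (v₀ : UnitAddTorus d → EuclideanSpace ℝ d) (t : ℝ) (x : UnitAddTorus d) (l : d) :
    vel ν θ u v₀ t x l = (velC ν θ u v₀ l t x).re := rfl

/-- The **pressure of the solution**: `Re Q`. [folklore] -/
def pres (ν θ : ℝ) (u : ℝ → UnitAddTorus d → EuclideanSpace ℝ d)
    (v₀ : UnitAddTorus d → EuclideanSpace ℝ d) : ℝ → UnitAddTorus d → ℝ :=
  fun t x => (presC ν θ u v₀ t x).re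

/-- Unfolding `pres`. [folklore] -/
@[simp]
theorem pres_apply (ν θ : ℝ) (u : ℝ → UnitAddTorus d → EuclideanSpace ℝ d)
    (v₀ : UnitAddTorus d → EuclideanSpace ℝ d) (t : ℝ) (x : UnitAddTorus d) :
    pres ν θ u v₀ t x = (presC ν θ u v₀ t x).re := rfl

end Data

end PerturbedNSFourier

end Literature.Analysis.FluidPDE

end
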